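import Mathlib
import HarnessLib
import Literature.MathematicalPhysics.StatisticalMechanics.RelevantHamiltonianSpace
import Literature.MathematicalPhysics.StatisticalMechanics.TuningLipschitzTorusFRD

/-!
# The tuning map `ℋ ↦ q(ℋ)` of [ABKM19] Ch. 12: the quadratic form of the Gaussian `μ^{(q)}` read off
# from the quadratic coefficients of the relevant Hamiltonian

In [ABKM19] Ch. 12 (Lemma 12.6, (12.8)–(12.11)) the renormalisation group for the initial datum
`K̂_0(𝒦, ℋ) = e^{−ℋ}𝒦` is run with the Gaussian `μ^{(q(ℋ))}`, where `q(ℋ)` is chosen so that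
`e^{−ℋ(Λ, φ)} μ^{(q)}(dφ) ∝ μ^{(0)}(dφ)`: with `ℋ({x}, φ) = λ + Σ_α a_α ∇^αφ(x) + Σ_{i≤j} a_{ij} ∇_iφ(x)∇_jφ(x)`
(`RelevantHamiltonians`) and `μ^{(q)} ∝ exp(−½ Σ_x ⟨(1+q)∇φ(x), ∇φ(x)⟩)` this is
`q_{ii} = −2 Re a_{ii}`, `q_{ij} = q_{ji} = −Re a_{ij}` (`i < j`) — real parts, which ARE the coefficients
on the `ι`-symmetric class (`IsIotaHam`).  This file defines that map and proves the three properties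
the assembled Lemma 12.6 (`TunedInitialConditionTorusFRD.exists_tuned_initial_of_torusFRD`) asks of a
tuning map:

* `hamQuadForm H` — the symmetric real matrix above; `hamQuadForm_isSymm`, `hamQuadForm_sub` (real-linearity),
  `entrySum_hamQuadForm_le` (`Σ_{ij}|q_{ij}| ≤ 2d²·‖H‖_{𝔥,R,n}/(n (𝔥/R)²)`);
* `hamTuningMap ρ x = hamQuadForm (toHam x)` on the `ρ`-ball and `0` outside; `hamTuningMap_isSymm`,
  `entrySum_hamTuningMap_le` (global bound `2d²ρ/(n(𝔥/R)²)`), `entrySum_hamTuningMap_sub_le` (Lipschitz on the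
  `ρ`-ball with constant `2d²/(n(𝔥/R)²)`).

Everything is proved; no named fact.  The Gaussian identity itself (change of quadratic form on the
torus) is not here.

## References
* S. Adams, S. Buchholz, R. Kotecký, S. Müller, arXiv:1910.13564, Ch. 12.1 (12.8)–(12.11), Lemma 12.6,
  Definition 6.5 (the family `μ^{(q)}`) [AdamsBuchholzKoteckyMuller2019].
-/

noncomputable section

namespace Literature.MathematicalPhysics.StatisticalMechanics.GradientRG

open scoped BigOperators
open Finset

variable {d : ℕ}

/-- **`q(H)`**: `q_{ii} = −2 Re a_{ii}`, `q_{ij} = q_{ji} = −Re a_{ij}` (`i < j`) from the quadratic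
coefficients `a_{ij}`, `i ≤ j`, of a relevant Hamiltonian.
[cite: AdamsBuchholzKoteckyMuller2019, Ch. 12.1 (12.8)–(12.11)] -/
def hamQuadForm (H : RelevantHamiltonian ℂ d) : Matrix (Fin d) (Fin d) ℝ := fun i j =>
  if hij : i ≤ j then (if i = j then (-2 : ℝ) else (-1 : ℝ)) * (H (Sum.inr (Sum.inr ⟨(i, j), hij⟩))).re
  else (-1 : ℝ) * (H (Sum.inr (Sum.inr ⟨(j, i), le_of_not_ge hij⟩))).re

/-- `q(H)` is symmetric. [cite: AdamsBuchholzKoteckyMuller2019, Ch. 12.1 (12.8)–(12.11)] -/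
theorem hamQuadForm_isSymm (H : RelevantHamiltonian ℂ d) : (hamQuadForm H).IsSymm := by
  ext i j
  simp only [Matrix.transpose_apply, hamQuadForm]
  by_cases hij : i ≤ j
  · by_cases hji : j ≤ i
    · have hEq : i = j := le_antisymm hij hji
      subst hEq
      simp
    · rw [dif_pos hij, dif_neg hji, if_neg (fun h => hji (le_of_eq h.symm))]
  · have hji : j ≤ i := le_of_not_ge hij
    rw [dif_neg hij, dif_pos hji, if_neg (fun h => hij (le_of_eq h.symm))]

/-- `q` is real-linear: `q(H − H') = q(H) − q(H')`. [cite: AdamsBuchholzKoteckyMuller2019, Ch. 12.1 (12.8)–(12.11)] -/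
theorem hamQuadForm_sub (H H' : RelevantHamiltonian ℂ d) : hamQuadForm (H - H') = hamQuadForm H - hamQuadForm H' := by
  ext i j
  simp only [hamQuadForm, Matrix.sub_apply, Pi.sub_apply, Complex.sub_re]
  split_ifs <;> ring

/-- Every entry of `q(H)` is at most twice the sum of the moduli of the quadratic coefficients.
[cite: AdamsBuchholzKoteckyMuller2019, Ch. 12.1 (12.8)–(12.11)] -/
theorem abs_hamQuadForm_le (H : RelevantHamiltonian ℂ d) (i j : Fin d) :
    |hamQuadForm H i j| ≤ 2 * ∑ q : quadIndex d, ‖H (Sum.inr (Sum.inr q))‖ := by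
  have hterm : ∀ q : quadIndex d, |(H (Sum.inr (Sum.inr q))).re| ≤ ∑ q' : quadIndex d, ‖H (Sum.inr (Sum.inr q'))‖ :=
    fun q => (Complex.abs_re_le_norm _).trans
      (single_le_sum (f := fun q' => ‖H (Sum.inr (Sum.inr q'))‖) (fun _ _ => norm_nonneg _) (mem_univ q))
  have h0 : 0 ≤ ∑ q' : quadIndex d, ‖H (Sum.inr (Sum.inr q'))‖ := sum_nonneg fun _ _ => norm_nonneg _
  unfold hamQuadForm
  split_ifs with hij hii
  · rw [abs_mul, abs_neg, abs_two]
    exact mul_le_mul_of_nonneg_left (hterm _) (by norm_num)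
  · rw [abs_mul, abs_neg, abs_one, one_mul]
    exact (hterm _).trans (by linarith)
  · rw [abs_mul, abs_neg, abs_one, one_mul]
    exact (hterm _).trans (by linarith)

/-- **`Σ_{ij}|q(H)_{ij}| ≤ 2d² · ‖H‖_{𝔥,R,n} / (n (𝔥/R)²)`** (`n ≥ 1`, `𝔥/R ≠ 0`).
[cite: AdamsBuchholzKoteckyMuller2019, Ch. 12.1 (12.8)–(12.11) / Ch. 6.4 (6.51)] -/
theorem entrySum_hamQuadForm_le {𝔥 R : ℝ} {n : ℕ} (h𝔥 : 0 < 𝔥) (hR : 0 < R) (hn : 1 ≤ n)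
    (H : RelevantHamiltonian ℂ d) :
    ∑ i, ∑ j, |hamQuadForm H i j| ≤ 2 * (d : ℝ) ^ 2 / ((n : ℝ) * (𝔥 / R) ^ 2) * hamNorm 𝔥 R n H := by
  set Sq := ∑ q : quadIndex d, ‖H (Sum.inr (Sum.inr q))‖ with hSq
  have hSq0 : 0 ≤ Sq := sum_nonneg fun _ _ => norm_nonneg _
  have h1 : ∑ i, ∑ j, |hamQuadForm H i j| ≤ (d : ℝ) ^ 2 * (2 * Sq) := by
    calc ∑ i, ∑ j, |hamQuadForm H i j| ≤ ∑ _i : Fin d, ∑ _j : Fin d, 2 * Sq :=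
          sum_le_sum fun i _ => sum_le_sum fun j _ => abs_hamQuadForm_le H i j
      _ = (d : ℝ) ^ 2 * (2 * Sq) := by
          rw [sum_const, sum_const, card_univ, Fintype.card_fin, nsmul_eq_mul, nsmul_eq_mul]; ring
  -- `n (𝔥/R)² Sq ≤ ‖H‖`
  have hn0 : (0 : ℝ) < n := by exact_mod_cast hn
  have h𝔥R : 0 < 𝔥 / R := div_pos h𝔥 hR
  have hpos : 0 < (n : ℝ) * (𝔥 / R) ^ 2 := by positivity
  have h2 : (n : ℝ) * (𝔥 / R) ^ 2 * Sq ≤ hamNorm 𝔥 R n H := by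
    have hq : ∑ q : quadIndex d, (𝔥 / R) ^ 2 * ‖H (Sum.inr (Sum.inr q))‖ = (𝔥 / R) ^ 2 * Sq := by
      rw [hSq, mul_sum]
    unfold hamNorm
    rw [hq]
    have ha : 0 ≤ ‖H (Sum.inl ())‖ := norm_nonneg _
    have hb : 0 ≤ ∑ α : linIndex d, 𝔥 * (R ^ (∑ i, (α : Fin d → ℕ) i))⁻¹ * ‖H (Sum.inr (Sum.inl α))‖ :=
      sum_nonneg fun α _ => by positivity
    calc (n : ℝ) * (𝔥 / R) ^ 2 * Sq = (n : ℝ) * ((𝔥 / R) ^ 2 * Sq) := by ring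
      _ ≤ (n : ℝ) * (‖H (Sum.inl ())‖ +
          ∑ α : linIndex d, 𝔥 * (R ^ (∑ i, (α : Fin d → ℕ) i))⁻¹ * ‖H (Sum.inr (Sum.inl α))‖ + (𝔥 / R) ^ 2 * Sq) :=
          mul_le_mul_of_nonneg_left (by linarith) hn0.le
  have h𝔥R0 : (𝔥 / R) ^ 2 ≠ 0 := by positivity
  calc ∑ i, ∑ j, |hamQuadForm H i j| ≤ (d : ℝ) ^ 2 * (2 * Sq) := h1
    _ = 2 * (d : ℝ) ^ 2 / ((n : ℝ) * (𝔥 / R) ^ 2) * ((n : ℝ) * (𝔥 / R) ^ 2 * Sq) := by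
        field_simp
    _ ≤ 2 * (d : ℝ) ^ 2 / ((n : ℝ) * (𝔥 / R) ^ 2) * hamNorm 𝔥 R n H :=
        mul_le_mul_of_nonneg_left h2 (by positivity)

/-! ## The tuning map on the Banach space of relevant Hamiltonians -/

/-- **The tuning map**: `q(toHam x)` on the `ρ`-ball, `0` outside (only the ball matters for Lemma 12.6).
[cite: AdamsBuchholzKoteckyMuller2019, Lemma 12.6] -/
def hamTuningMap {𝔥 R : ℝ} {n : ℕ} [Fact (0 < 𝔥)] [Fact (0 < R)] [Fact (0 < n)] (ρ : ℝ) (x : HamSpace ℂ d 𝔥 R n) :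
    Matrix (Fin d) (Fin d) ℝ :=
  if ‖x‖ ≤ ρ then hamQuadForm (HamSpace.toHam x) else 0

/-- On the ball the tuning map is `q(toHam x)`. [cite: AdamsBuchholzKoteckyMuller2019, Lemma 12.6] -/
theorem hamTuningMap_of_le {𝔥 R : ℝ} {n : ℕ} [Fact (0 < 𝔥)] [Fact (0 < R)] [Fact (0 < n)] {ρ : ℝ}
    {x : HamSpace ℂ d 𝔥 R n} (hx : ‖x‖ ≤ ρ) :
    hamTuningMap ρ x = hamQuadForm (HamSpace.toHam x) := if_pos hx

/-- The tuning map has symmetric values. [cite: AdamsBuchholzKoteckyMuller2019, Lemma 12.6] -/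
theorem hamTuningMap_isSymm {𝔥 R : ℝ} {n : ℕ} [Fact (0 < 𝔥)] [Fact (0 < R)] [Fact (0 < n)] (ρ : ℝ)
    (x : HamSpace ℂ d 𝔥 R n) : (hamTuningMap ρ x).IsSymm := by
  unfold hamTuningMap
  split_ifs
  · exact hamQuadForm_isSymm _
  · exact Matrix.isSymm_zero

/-- **Global entry-sum bound**: `Σ|hamTuningMap ρ x| ≤ 2d²ρ/(n(𝔥/R)²)`.
[cite: AdamsBuchholzKoteckyMuller2019, Lemma 12.6] -/
theorem entrySum_hamTuningMap_le {𝔥 R : ℝ} {n : ℕ} [Fact (0 < 𝔥)] [Fact (0 < R)] [Fact (0 < n)]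
    {ρ : ℝ} (hρ : 0 ≤ ρ) (x : HamSpace ℂ d 𝔥 R n) :
    ∑ i, ∑ j, |hamTuningMap ρ x i j| ≤ 2 * (d : ℝ) ^ 2 / ((n : ℝ) * (𝔥 / R) ^ 2) * ρ := by
  have h𝔥 : 0 < 𝔥 := Fact.out
  have hR : 0 < R := Fact.out
  have hn : 1 ≤ n := Nat.one_le_iff_ne_zero.2 (Nat.pos_iff_ne_zero.1 (Fact.out : 0 < n))
  have hc : 0 ≤ 2 * (d : ℝ) ^ 2 / ((n : ℝ) * (𝔥 / R) ^ 2) := by positivity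
  unfold hamTuningMap
  split_ifs with hx
  · refine (entrySum_hamQuadForm_le h𝔥 hR hn _).trans ?_
    rw [← HamSpace.norm_def]
    exact mul_le_mul_of_nonneg_left hx hc
  · simp only [Matrix.zero_apply, abs_zero, sum_const_zero]
    positivity

/-- **Lipschitz bound on the ball**: `Σ|hamTuningMap ρ x − hamTuningMap ρ x'| ≤ (2d²/(n(𝔥/R)²))·‖x − x'‖` for
`‖x‖, ‖x'‖ ≤ ρ`. [cite: AdamsBuchholzKoteckyMuller2019, Lemma 12.6] -/
theorem entrySum_hamTuningMap_sub_le {𝔥 R : ℝ} {n : ℕ} [Fact (0 < 𝔥)] [Fact (0 < R)] [Fact (0 < n)]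
    {ρ : ℝ} (x x' : HamSpace ℂ d 𝔥 R n) (hx : ‖x‖ ≤ ρ) (hx' : ‖x'‖ ≤ ρ) :
    ∑ i, ∑ j, |(hamTuningMap ρ x - hamTuningMap ρ x') i j| ≤
      2 * (d : ℝ) ^ 2 / ((n : ℝ) * (𝔥 / R) ^ 2) * ‖x - x'‖ := by
  have h𝔥 : 0 < 𝔥 := Fact.out
  have hR : 0 < R := Fact.out
  have hn : 1 ≤ n := Nat.one_le_iff_ne_zero.2 (Nat.pos_iff_ne_zero.1 (Fact.out : 0 < n))
  rw [hamTuningMap_of_le hx, hamTuningMap_of_le hx', ← hamQuadForm_sub, ← map_sub, HamSpace.norm_def]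
  exact entrySum_hamQuadForm_le h𝔥 hR hn _

end Literature.MathematicalPhysics.StatisticalMechanics.GradientRG

end
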